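import Literature.LinearAlgebra.Matrix.PatternMarginsCutConditions
import Literature.LinearAlgebra.Matrix.SymmetricMatrixScaling
import HarnessLib

/-!
# Brualdi's partition conditions for symmetric matrices with prescribed pattern and row sums — sufficiency
# (Idel Theorem 5.4 (3) ⇒ (2), hence (1) ⇔ (2) ⇔ (3): a symmetric `A ≥ 0` has a positive symmetric scaling `DAD` with
# row sums `r` iff `Σ_I r ≥ Σ_K r` for all partitions `{I, J, K}` with `A(J ∪ K, K) = 0`, with equality iff
# `A(I, I ∪ J) = 0`)

Layer `Literature/LinearAlgebra/Matrix`, namespace `Literature.LinearAlgebra.Matrix.SymmetricPatternCutConditions`.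
Written for lane `lit-hodgefound` (prover seat `lit-hodgefound-p31`, gen 42, row g42-#4); completes
✔ `ScalingCutConditions.lean` (g41-#13, necessity (2) ⇒ (3)) and ✔ `SymmetricMatrixScaling.lean` (g41-#12, (1) ⇔ (2))
with the sufficiency (3) ⇒ (2), obtained from the bipartite theorem ✔ `PatternMarginsCutConditions.lean` (g42-#3,
Menon–Brualdi: Idel Theorem 4.1 (iv) ⇒ (ii)) by SYMMETRISATION: for symmetric `A` the partition conditions imply
Menon's cut conditions for the margins `(r, r)`, and if `B` has the pattern of `A` with row AND column sums `r`, then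
`(B + Bᵀ)/2` is symmetric with the same pattern and row sums `r`. Everything is PROVED; no definition, no named fact.

## Source (held text, verbatim)

M. Idel, *A review of matrix scaling …*, arXiv:1609.06349 [cite: Idel2016] (held text `paper:arxiv-1609.06349`), §5
Theorem 5.4 ([bru74]), p0015–p0016: «Let `A ∈ ℝ^{n×n}` be a symmetric nonnegative matrix. Then the following are
equivalent: • There exists a diagonal matrix `D` with positive entries such that `DAD` has row sums given by
`r ∈ ℝ^n_+`. • There exists a symmetric nonnegative matrix `B` with the same pattern as `A` and row sums `r`. • For all
partitions `{I,J,K}` of `{1,…,n}` such that `A(J∪K,K) = 0`, `Σ_{i∈I} r_i ≥ Σ_{i∈K} r_i` with equality if and only if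
`A(I,I∪J) = 0`. Furthermore, the scaling is unique. The equivalence of 2. and 3. is given in [bru68]. 1. follows from
2. using Sinkhorn's theorem and the reverse direction is proved via contradiction.»

## What is proved

* `menon_of_brualdi_partition`: for symmetric `A`, condition (3) — stated for DISJOINT `I`, `K` (`J = (I ∪ K)ᶜ`,
  `A(J ∪ K, K) = A(Iᶜ, K) = 0`, equality clause `A(I, I ∪ J) = A(I, Kᶜ) = 0`) — implies the same inequalities for
  arbitrary `I`, `K`, i.e. Menon's cut conditions of Theorem 4.1 (iv) for the margins `(r, r)` (pass to `I ∖ K`,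
  `K ∖ I`; symmetry moves the common part `I ∩ K`).
* **`exists_symm_pattern_rowSums_of_partition`** — Theorem 5.4 (3) ⇒ (2) (for `r ≥ 0`; `A` symmetric, its sign
  irrelevant): symmetrise the matrix of ✔ `PatternMarginsCutConditions.exists_pattern_margins_of_menon`.
* **`Idel2016_thm_5_4_pattern_iff_partition`** ((2) ⇔ (3)) and **`Idel2016_thm_5_4_scaling_iff_partition`**
  ((1) ⇔ (3), `A ≥ 0` symmetric) with ✔ g41-#13 and ✔ g41-#12.

DECLARED deviations. (i) `r` nonnegative (print `ℝ^n_+`); (ii) the partition `{I, J, K}` is rendered by disjoint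
finsets `I`, `K` with `J := (I ∪ K)ᶜ` (so `J ∪ K = Iᶜ` and `I ∪ J = Kᶜ`); (iii) index type in `Type` (universe of
the tree's Hoffman theorem behind g42-#3). The uniqueness clause is ✔ `SymmetricMatrixScaling` (g41-#12).
-/

open Finset Matrix

namespace Literature.LinearAlgebra.Matrix.SymmetricPatternCutConditions

variable {n : Type} [Fintype n] [DecidableEq n] {A : Matrix n n ℝ} {r : n → ℝ}

omit [Fintype n] in
/-- **The partition conditions imply Menon's cut conditions (symmetric `A`, margins `(r, r)`).** If for all disjoint
`I`, `K` with `A(Iᶜ, K) = 0` one has `Σ_K r ≤ Σ_I r` with equality iff `A(I, Kᶜ) = 0`, then the same holds for ALL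
`I`, `K` with `A(Iᶜ, K) = 0`. [cite: Idel2016, §5 Theorem 5.4 ((3), via Theorem 4.1 (iv)), p0016] -/
theorem menon_of_brualdi_partition (hAs : ∀ i j, A i j = A j i)
    (h : ∀ I K : Finset n, Disjoint I K → (∀ i ∉ I, ∀ k ∈ K, A i k = 0) →
      ∑ k ∈ K, r k ≤ ∑ i ∈ I, r i ∧ (∑ k ∈ K, r k = ∑ i ∈ I, r i ↔ ∀ i ∈ I, ∀ l ∉ K, A i l = 0))
    (I K : Finset n) (hzero : ∀ i ∉ I, ∀ k ∈ K, A i k = 0) :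
    ∑ k ∈ K, r k ≤ ∑ i ∈ I, r i ∧ (∑ k ∈ K, r k = ∑ i ∈ I, r i ↔ ∀ i ∈ I, ∀ l ∉ K, A i l = 0) := by
  have hdisj : Disjoint (I \ K) (K \ I) := disjoint_sdiff_self_left.mono_right sdiff_subset
  have hzero' : ∀ i ∉ I \ K, ∀ k ∈ K \ I, A i k = 0 := fun i hi k hk ↦ by
    rw [mem_sdiff] at hi hk
    by_cases hiI : i ∈ I
    · -- then `i ∈ K`, and `A i k = A k i = 0` since `k ∉ I`, `i ∈ K`
      have hiK : i ∈ K := by by_contra hiK; exact hi ⟨hiI, hiK⟩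
      rw [hAs]; exact hzero k hk.2 i hiK
    · exact hzero i hiI k hk.1
  obtain ⟨hle, hiff⟩ := h (I \ K) (K \ I) hdisj hzero'
  -- split off the common part `I ∩ K`
  have hK : ∑ k ∈ K, r k = ∑ k ∈ K \ I, r k + ∑ k ∈ K ∩ I, r k := by
    rw [← sum_sdiff (inter_subset_left (s₁ := K) (s₂ := I)), sdiff_inter_self_left]
  have hI : ∑ i ∈ I, r i = ∑ i ∈ I \ K, r i + ∑ i ∈ I ∩ K, r i := by
    rw [← sum_sdiff (inter_subset_left (s₁ := I) (s₂ := K)), sdiff_inter_self_left]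
  have hcomm : ∑ k ∈ K ∩ I, r k = ∑ i ∈ I ∩ K, r i := by rw [inter_comm]
  refine ⟨by rw [hK, hI, hcomm]; linarith, ?_⟩
  rw [hK, hI, hcomm, add_left_inj, hiff]
  constructor
  · intro H i hi l hl
    by_cases hiK : i ∈ K
    · by_cases hlI : l ∈ I
      · -- `l ∈ I ∖ K`, `i ∈ I ∩ K ∌ K ∖ I`: `A i l = A l i = 0`
        rw [hAs]
        exact H l (mem_sdiff.2 ⟨hlI, hl⟩) i fun h' ↦ (mem_sdiff.1 h').2 hi
      · -- `l ∉ I`, `i ∈ K`: the hypothesis `A(Iᶜ, K) = 0` read symmetrically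
        rw [hAs]; exact hzero l hlI i hiK
    · exact H i (mem_sdiff.2 ⟨hi, hiK⟩) l fun h' ↦ hl (mem_sdiff.1 h').1
  · intro H i hi l hl
    rw [mem_sdiff] at hi
    by_cases hlK : l ∈ K
    · -- then `l ∈ I`; `A i l = A l i = 0` since `l ∈ I`, `i ∉ K`
      have hlI : l ∈ I := by by_contra hlI; exact hl (mem_sdiff.2 ⟨hlK, hlI⟩)
      rw [hAs]; exact H l hlI i hi.2
    · exact H i hi.1 l hlK

/-- **Idel Theorem 5.4, (3) ⇒ (2) (Brualdi 1968: sufficiency of the partition conditions).** Let `A` be symmetric and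
`r ≥ 0`. If for all partitions `{I, J, K}` (disjoint `I`, `K`, `J = (I ∪ K)ᶜ`) with `A(J ∪ K, K) = 0`:
`Σ_{k∈K} r_k ≤ Σ_{i∈I} r_i`, with equality iff `A(I, I ∪ J) = 0`, then there is a SYMMETRIC `B ≥ 0` with the pattern
of `A` and row sums `r` («There exists a symmetric nonnegative matrix `B` with the same pattern as `A` and row sums
`r`»): symmetrise (`(B + Bᵀ)/2`) the matrix with pattern `A`, row sums `r` and column sums `r` given by Theorem 4.1
(iv) ⇒ (ii). [cite: Idel2016, §5 Theorem 5.4 ((3) ⇒ (2)), p0016] -/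
theorem exists_symm_pattern_rowSums_of_partition (hAs : ∀ i j, A i j = A j i) (hr : ∀ i, 0 ≤ r i)
    (h : ∀ I K : Finset n, Disjoint I K → (∀ i ∉ I, ∀ k ∈ K, A i k = 0) →
      ∑ k ∈ K, r k ≤ ∑ i ∈ I, r i ∧ (∑ k ∈ K, r k = ∑ i ∈ I, r i ↔ ∀ i ∈ I, ∀ l ∉ K, A i l = 0)) :
    ∃ B : Matrix n n ℝ, (∀ i j, 0 ≤ B i j) ∧ (∀ i j, B i j = B j i) ∧ (∀ i j, A i j = 0 ↔ B i j = 0) ∧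
      ∀ i, ∑ j, B i j = r i := by
  obtain ⟨B, hB, hpat, hBr, hBc⟩ := PatternMarginsCutConditions.exists_pattern_margins_of_menon A hr hr
    fun I K hz ↦ menon_of_brualdi_partition hAs h I K hz
  refine ⟨of fun i j ↦ (B i j + B j i) / 2, fun i j ↦ ?_, fun i j ↦ ?_, fun i j ↦ ?_, fun i ↦ ?_⟩
  · simp only [of_apply]; linarith [hB i j, hB j i]
  · simp only [of_apply]; rw [add_comm]
  · simp only [of_apply]
    constructor
    · intro hij
      have hji : A j i = 0 := by rw [hAs]; exact hij
      rw [(hpat i j).1 hij, (hpat j i).1 hji]; norm_num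
    · intro hij
      have h0 : B i j = 0 := by linarith [hB i j, hB j i]
      exact (hpat i j).2 h0
  · simp only [of_apply]
    rw [← sum_div, sum_add_distrib, hBr i, hBc i]
    ring

/-- **Idel Theorem 5.4, (2) ⇔ (3)** (symmetric `A`, `r ≥ 0`): a symmetric nonnegative matrix with the pattern of `A` and
row sums `r` exists iff the partition conditions hold (necessity: ✔ `ScalingCutConditions.brualdi_condition_of_pattern`).
[cite: Idel2016, §5 Theorem 5.4 ((2) ⇔ (3)), p0016] -/
theorem Idel2016_thm_5_4_pattern_iff_partition (hAs : ∀ i j, A i j = A j i) (hr : ∀ i, 0 ≤ r i) :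
    (∃ B : Matrix n n ℝ, (∀ i j, 0 ≤ B i j) ∧ (∀ i j, B i j = B j i) ∧ (∀ i j, A i j = 0 ↔ B i j = 0) ∧
      ∀ i, ∑ j, B i j = r i) ↔
    ∀ I K : Finset n, Disjoint I K → (∀ i ∉ I, ∀ k ∈ K, A i k = 0) →
      ∑ k ∈ K, r k ≤ ∑ i ∈ I, r i ∧ (∑ k ∈ K, r k = ∑ i ∈ I, r i ↔ ∀ i ∈ I, ∀ l ∉ K, A i l = 0) := by
  constructor
  · rintro ⟨B, hB, hBs, hpat, hBr⟩ I K - hzero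
    exact ScalingCutConditions.brualdi_condition_of_pattern hB hBs hpat hBr hzero
  · exact exists_symm_pattern_rowSums_of_partition hAs hr

/-- **Idel Theorem 5.4, (1) ⇔ (3) (Brualdi 1974 with Brualdi 1968)** for symmetric `A ≥ 0` and `r ≥ 0`: there is a
positive diagonal `D` with `DAD` having row sums `r` iff for all partitions `{I, J, K}` with `A(J ∪ K, K) = 0`,
`Σ_{i∈I} r_i ≥ Σ_{k∈K} r_k` with equality iff `A(I, I ∪ J) = 0` ((1) ⇔ (2) is ✔ `SymmetricMatrixScaling.Idel2016_thm_5_4`).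
[cite: Idel2016, §5 Theorem 5.4 ((1) ⇔ (3)), p0016] -/
theorem Idel2016_thm_5_4_scaling_iff_partition (hA : ∀ i j, 0 ≤ A i j) (hAs : ∀ i j, A i j = A j i)
    (hr : ∀ i, 0 ≤ r i) :
    (∃ d : n → ℝ, (∀ i, 0 < d i) ∧ ∀ i, ∑ j, d i * A i j * d j = r i) ↔
    ∀ I K : Finset n, Disjoint I K → (∀ i ∉ I, ∀ k ∈ K, A i k = 0) →
      ∑ k ∈ K, r k ≤ ∑ i ∈ I, r i ∧ (∑ k ∈ K, r k = ∑ i ∈ I, r i ↔ ∀ i ∈ I, ∀ l ∉ K, A i l = 0) := by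
  rw [SymmetricMatrixScaling.Idel2016_thm_5_4 hA hAs]
  exact Idel2016_thm_5_4_pattern_iff_partition hAs hr

end Literature.LinearAlgebra.Matrix.SymmetricPatternCutConditions
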